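import Literature.Analysis.OperatorTheory.Enflo2023.Vy
import HarnessLib

/-!
# Enflo (2023), arXiv:2305.15442v2 — the phase insert on p. 6 (tex L198–L204): what follows and what does not

Source under adjudication: P. Enflo, *On the invariant subspace problem in Hilbert spaces*,
arXiv:2305.15442v2 (6 April 2024).  This module belongs to the repair-cell record of the
CLAIMED proof (Formaliser 1, Part A, STEPS row A13).  NOTHING here asserts that the paper's
argument is correct; every declaration is either a kernel-checked lemma that the text uses, or a
kernel-checked statement recording precisely which printed inference does not follow.
Value (BLOCK-2b): typed inferences about a text — not progress on the invariant subspace problem.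

## WHAT THIS FILE TYPES (v2 p. 6, the insert between (15) and (16))

The text: *"When moving `y` within distance `ε` from `x₀` by an `ℓ(T) = Σ a_j T^j` with `Σ|a_j|²`
minimal, we arrive at the same point `ℓ(T)y = x₀ − [ ]⁻¹x₀`, whether we move `y` or `y·e^{ir}`,
`r ∈ ℝ`, or whether we use the operator `T` or the operator `e^{is}T`, `s ∈ ℝ`.  This affects
`a_m = ⟨[ ]⁻¹x₀, T^m y⟩` and `b_m = …` and below without loss of generality we can assume the values
of the integrals in (28″)–(30″) below to be real numbers …"*

* FIRST HALF — FOLLOWS (`Vy.endpoint_phase_invariant`, `Vy.coeff_phase`).  With the paper's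
  `V_y : ℓ² → H`, `a ↦ Σ a_j T^j y` (`Vy.V`), replacing `(y, T)` by `(e^{ir}y, e^{is}T)` replaces
  `V_y` by `V_y ∘ D_{r,s}` where `D_{r,s}` is the diagonal unitary `a_j ↦ e^{i(r+js)}a_j` of `ℓ²`
  (`Vy.phaseDiag`, `Vy.V_phase`); `D_{r,s}` preserves the `ℓ²`-norm and maps the feasible set of
  problem (1) for `(e^{ir}y, e^{is}T)` onto the one for `(y, T)` (`Vy.isMinimal_phase_iff`), so the
  (unique) minimal vectors correspond, `a = D_{r,s} a'`, and the end points `ℓ'(e^{is}T)(e^{ir}y)`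
  and `ℓ(T)y` coincide.  The minimal coefficients transform by `a'_j = e^{-i(r+js)} a_j`
  (`Vy.coeff_phase`) — this is the whole content of "this affects `a_m`".
* SECOND HALF — DOES NOT FOLLOW (`PhaseWlog.not_wlog_real_three`).  The symmetry supplies two real
  parameters `r, s`, acting on every quantity built from the coefficients through unimodular
  characters `e^{i(pr + qs)}`.  Two parameters cannot in general make THREE quantities with
  distinct characters simultaneously real: for the characters of the coefficients `a₀, a₁, a₂`
  (`j = 0, 1, 2`) and the values `1, 1, i` no choice of `(r, s)` makes all three real
  (`PhaseWlog.not_wlog_real_three`; elementary trigonometry).  The integrals (28″)–(30″) are Part B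
  heuristics (first-order expressions in the `a_m`, `b_m`, `κ_m`), typed as far as they can be in
  the Formaliser 2 record; the present lemma exhibits the failing INFERENCE PATTERN ("two free
  phases ⇒ three quantities WLOG real"), it is not a statement about those integrals, and the
  matter is off the path to the first gap of the paper ((27), p. 13).

Dictionary: the paper's `⟨u, v⟩` (linear in `u`) is Mathlib's `⟪v, u⟫_ℂ`; `ℓ2 = lp (fun _ : ℕ => ℂ) 2`.
-/

open scoped InnerProductSpace ENNReal
open Complex

noncomputable section

namespace Literature.Analysis.OperatorTheory.Enflo2023

namespace Vy

variable {H : Type*} [NormedAddCommGroup H] [InnerProductSpace ℂ H] [CompleteSpace H]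

/-- The character `χ_{r,s}(j) = e^{i(r + j s)}` by which the substitution `(y, T) ↦ (e^{ir}y, e^{is}T)`
acts on the `j`-th coefficient direction. [cite: Enflo2023, v2 p.6, insert (tex L198–L204)] -/
def phaseChar (r s : ℝ) (j : ℕ) : ℂ := Complex.exp (((r + j * s : ℝ) : ℂ) * I)

/-- `|χ_{r,s}(j)| = 1`. [folklore] -/
lemma norm_phaseChar (r s : ℝ) (j : ℕ) : ‖phaseChar r s j‖ = 1 :=
  Complex.norm_exp_ofReal_mul_I _

/-- `χ_{-r,-s}(j) · χ_{r,s}(j) = 1`. [folklore] -/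
lemma phaseChar_neg_mul (r s : ℝ) (j : ℕ) : phaseChar (-r) (-s) j * phaseChar r s j = 1 := by
  rw [phaseChar, phaseChar, ← Complex.exp_add]
  convert Complex.exp_zero using 2
  push_cast
  ring

/-- `χ_{r,s}(j) = e^{is·j} · e^{ir}` as a product of the two phases. [folklore] -/
lemma phaseChar_eq_pow_mul (r s : ℝ) (j : ℕ) :
    phaseChar r s j = Complex.exp ((s : ℂ) * I) ^ j * Complex.exp ((r : ℂ) * I) := by
  rw [phaseChar, ← Complex.exp_nat_mul, ← Complex.exp_add]
  congr 1
  push_cast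
  ring

/-- Multiplying an `ℓ²` sequence by unimodular characters keeps it in `ℓ²`. [folklore] -/
lemma memℓp_phaseChar_mul (r s : ℝ) (a : ℓ2) : Memℓp (fun j => phaseChar r s j * a j) 2 := by
  rw [memℓp_gen_iff (by norm_num : 0 < (2 : ℝ≥0∞).toReal)]
  simp only [ENNReal.toReal_ofNat, Real.rpow_two, norm_mul, norm_phaseChar, one_mul]
  exact summable_sq a

/-- The diagonal map `a_j ↦ e^{i(r+js)} a_j` of `ℓ²`, as a linear map. [cite: Enflo2023, v2 p.6, insert (tex L198–L204)] -/
def phaseDiagLin (r s : ℝ) : ℓ2 →ₗ[ℂ] ℓ2 where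
  toFun a := ⟨fun j => phaseChar r s j * a j, memℓp_phaseChar_mul r s a⟩
  map_add' a b := by
    apply lp.ext
    funext j
    simp only [lp.coeFn_add, Pi.add_apply]
    exact mul_add _ _ _
  map_smul' c a := by
    apply lp.ext
    funext j
    simp only [lp.coeFn_smul, Pi.smul_apply, smul_eq_mul, RingHom.id_apply]
    exact mul_left_comm _ _ _

/-- Coordinates of the diagonal phase map. [folklore] -/
lemma phaseDiagLin_apply (r s : ℝ) (a : ℓ2) (j : ℕ) :
    (phaseDiagLin r s a) j = phaseChar r s j * a j := rfl

/-- The diagonal phase map is an isometry of `ℓ²`. [folklore] -/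
lemma norm_phaseDiagLin (r s : ℝ) (a : ℓ2) : ‖phaseDiagLin r s a‖ = ‖a‖ := by
  have h1 := hasSum_sq (phaseDiagLin r s a)
  have h3 : (fun j => ‖(phaseDiagLin r s a) j‖ ^ 2) = fun j => ‖a j‖ ^ 2 := by
    funext j
    rw [phaseDiagLin_apply, norm_mul, norm_phaseChar, one_mul]
  rw [h3] at h1
  have h4 : ‖phaseDiagLin r s a‖ ^ 2 = ‖a‖ ^ 2 := h1.unique (hasSum_sq a)
  exact (pow_left_inj₀ (norm_nonneg _) (norm_nonneg _) two_ne_zero).1 h4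

/-- **The diagonal unitary `D_{r,s} : a_j ↦ e^{i(r+js)} a_j` of `ℓ²`** implementing the substitution
`(y, T) ↦ (e^{ir}y, e^{is}T)` on coefficient vectors. [cite: Enflo2023, v2 p.6, insert (tex L198–L204)] -/
def phaseDiag (r s : ℝ) : ℓ2 →L[ℂ] ℓ2 :=
  (phaseDiagLin r s).mkContinuous 1 (fun a => by rw [norm_phaseDiagLin, one_mul])

/-- Coordinates: `(D_{r,s} a)_j = e^{i(r+js)} a_j`. [cite: Enflo2023, v2 p.6, insert (tex L198–L204)] -/
@[simp] lemma phaseDiag_apply (r s : ℝ) (a : ℓ2) (j : ℕ) :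
    (phaseDiag r s a) j = phaseChar r s j * a j := rfl

/-- `D_{r,s}` preserves the `ℓ²`-norm (it is a diagonal unitary). [folklore] -/
lemma norm_phaseDiag_apply (r s : ℝ) (a : ℓ2) : ‖phaseDiag r s a‖ = ‖a‖ := norm_phaseDiagLin r s a

/-- `D_{-r,-s} D_{r,s} = id`. [folklore] -/
lemma phaseDiag_neg_apply (r s : ℝ) (a : ℓ2) : phaseDiag (-r) (-s) (phaseDiag r s a) = a := by
  apply lp.ext
  funext j
  rw [phaseDiag_apply, phaseDiag_apply, ← mul_assoc, phaseChar_neg_mul, one_mul]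

/-- `D_{r,s} D_{-r,-s} = id`. [folklore] -/
lemma phaseDiag_apply_neg (r s : ℝ) (a : ℓ2) : phaseDiag r s (phaseDiag (-r) (-s) a) = a := by
  simpa using phaseDiag_neg_apply (-r) (-s) a

/-- Multiplying the operator by a phase does not change its norm: `‖e^{is}T‖ = ‖T‖`. [folklore] -/
lemma norm_phase_smul (s : ℝ) (T : H →L[ℂ] H) : ‖Complex.exp ((s : ℂ) * I) • T‖ = ‖T‖ := by
  rw [norm_smul, Complex.norm_exp_ofReal_mul_I, one_mul]

/-- **`V_{e^{ir}y}^{(e^{is}T)} = V_y^{(T)} ∘ D_{r,s}`**: the substitution `(y, T) ↦ (e^{ir}y, e^{is}T)` acts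
on the move operator of (2) by the diagonal unitary of `ℓ²`.
[cite: Enflo2023, v2 p.6, insert (tex L198–L204)] -/
theorem V_phase (T : H →L[ℂ] H) (hT : ‖T‖ < 1) (y : H) (r s : ℝ)
    (hT' : ‖Complex.exp ((s : ℂ) * I) • T‖ < 1) (a : ℓ2) :
    V (Complex.exp ((s : ℂ) * I) • T) hT' (Complex.exp ((r : ℂ) * I) • y) a
      = V T hT y (phaseDiag r s a) := by
  rw [V_apply, V_apply]
  refine tsum_congr fun j => ?_
  rw [smul_pow, FunLike.coe_smul, Pi.smul_apply, map_smul, smul_smul, smul_smul,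
    phaseDiag_apply, phaseChar_eq_pow_mul]
  congr 1
  ring

/-- The feasible sets of problem (1) for `(e^{ir}y, e^{is}T)` and for `(y, T)` correspond under `D_{r,s}`.
[cite: Enflo2023, v2 p.6, insert (tex L198–L204)] -/
theorem mem_feasible_phase_iff (T : H →L[ℂ] H) (hT : ‖T‖ < 1) (y x₀ : H) (ε : ℝ) (r s : ℝ)
    (hT' : ‖Complex.exp ((s : ℂ) * I) • T‖ < 1) (a : ℓ2) :
    a ∈ feasible (V (Complex.exp ((s : ℂ) * I) • T) hT' (Complex.exp ((r : ℂ) * I) • y)) x₀ ε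
      ↔ phaseDiag r s a ∈ feasible (V T hT y) x₀ ε := by
  rw [mem_feasible, mem_feasible, V_phase]

/-- **Minimal vectors correspond**: `a` is the minimal solution of (1) for `(e^{ir}y, e^{is}T)` iff
`D_{r,s} a` is the minimal solution for `(y, T)` (the diagonal unitary preserves `‖·‖₂` and maps one
feasible set onto the other). [cite: Enflo2023, v2 p.6, insert (tex L198–L204)] -/
theorem isMinimal_phase_iff (T : H →L[ℂ] H) (hT : ‖T‖ < 1) (y x₀ : H) (ε : ℝ) (r s : ℝ)
    (hT' : ‖Complex.exp ((s : ℂ) * I) • T‖ < 1) (a : ℓ2) :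
    IsMinimal (V (Complex.exp ((s : ℂ) * I) • T) hT' (Complex.exp ((r : ℂ) * I) • y)) x₀ ε a
      ↔ IsMinimal (V T hT y) x₀ ε (phaseDiag r s a) := by
  constructor
  · rintro ⟨ha, hmin⟩
    refine ⟨(mem_feasible_phase_iff T hT y x₀ ε r s hT' a).1 ha, fun b hb => ?_⟩
    have hb' : phaseDiag (-r) (-s) b ∈
        feasible (V (Complex.exp ((s : ℂ) * I) • T) hT' (Complex.exp ((r : ℂ) * I) • y)) x₀ ε := by
      rw [mem_feasible_phase_iff T hT y x₀ ε r s hT', phaseDiag_apply_neg]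
      exact hb
    calc ‖phaseDiag r s a‖ = ‖a‖ := norm_phaseDiag_apply r s a
      _ ≤ ‖phaseDiag (-r) (-s) b‖ := hmin _ hb'
      _ = ‖b‖ := norm_phaseDiag_apply _ _ b
  · rintro ⟨ha, hmin⟩
    refine ⟨(mem_feasible_phase_iff T hT y x₀ ε r s hT' a).2 ha, fun b hb => ?_⟩
    calc ‖a‖ = ‖phaseDiag r s a‖ := (norm_phaseDiag_apply r s a).symm
      _ ≤ ‖phaseDiag r s b‖ := hmin _ ((mem_feasible_phase_iff T hT y x₀ ε r s hT' b).1 hb)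
      _ = ‖b‖ := norm_phaseDiag_apply r s b

/-- **p. 6 insert, first half (FOLLOWS): the end point `ℓ(T)y` of the minimal move is the same for
`(y, T)` and for `(e^{ir}y, e^{is}T)`.** [cite: Enflo2023, v2 p.6, insert (tex L198–L204)] -/
theorem endpoint_phase_invariant (T : H →L[ℂ] H) (hT : ‖T‖ < 1) (y x₀ : H) (ε : ℝ) (r s : ℝ)
    (hT' : ‖Complex.exp ((s : ℂ) * I) • T‖ < 1) {a a' : ℓ2} (ha : IsMinimal (V T hT y) x₀ ε a)
    (ha' : IsMinimal (V (Complex.exp ((s : ℂ) * I) • T) hT' (Complex.exp ((r : ℂ) * I) • y)) x₀ ε a') :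
    V (Complex.exp ((s : ℂ) * I) • T) hT' (Complex.exp ((r : ℂ) * I) • y) a' = V T hT y a := by
  have h1 := (isMinimal_phase_iff T hT y x₀ ε r s hT' a').1 ha'
  rw [V_phase, h1.unique ha]

/-- **"This affects `a_m`"**: the minimal coefficients for `(e^{ir}y, e^{is}T)` are `a'_j = e^{-i(r+js)} a_j`.
[cite: Enflo2023, v2 p.6, insert (tex L198–L204)] -/
theorem coeff_phase (T : H →L[ℂ] H) (hT : ‖T‖ < 1) (y x₀ : H) (ε : ℝ) (r s : ℝ)
    (hT' : ‖Complex.exp ((s : ℂ) * I) • T‖ < 1) {a a' : ℓ2} (ha : IsMinimal (V T hT y) x₀ ε a)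
    (ha' : IsMinimal (V (Complex.exp ((s : ℂ) * I) • T) hT' (Complex.exp ((r : ℂ) * I) • y)) x₀ ε a')
    (j : ℕ) : a' j = phaseChar (-r) (-s) j * a j := by
  have h1 := (isMinimal_phase_iff T hT y x₀ ε r s hT' a').1 ha'
  have h2 : phaseDiag r s a' = a := h1.unique ha
  have h3 : a' = phaseDiag (-r) (-s) a := by rw [← h2, phaseDiag_neg_apply]
  rw [h3, phaseDiag_apply]

end Vy

namespace PhaseWlog

open Vy

/-- Values `1, 1, i` on the first three coefficient directions — the witness against "WLOG real".
[cite: Enflo2023, v2 p.6, insert (tex L198–L204)] -/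
def wlogWitness : ℕ → ℂ := fun j => if j = 2 then I else 1

/-- `z₀ = 1`. [folklore] -/
lemma wlogWitness_zero : wlogWitness 0 = 1 := rfl
/-- `z₁ = 1`. [folklore] -/
lemma wlogWitness_one : wlogWitness 1 = 1 := rfl
/-- `z₂ = i`. [folklore] -/
lemma wlogWitness_two : wlogWitness 2 = I := rfl

/-- **p. 6 insert, second half (DOES NOT FOLLOW): two free phases cannot make three quantities with the
characters of `a₀, a₁, a₂` simultaneously real.**  For the values `1, 1, i` and every `(r, s)`, one of
`e^{i(r+js)}·z_j`, `j ≤ 2`, has non-zero imaginary part (if `sin r = sin(r+s) = 0` then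
`cos(r+2s) = ±1`). [cite: Enflo2023, v2 p.6, insert (tex L198–L204)] -/
theorem not_wlog_real_three (r s : ℝ) : ∃ j ≤ 2, (phaseChar r s j * wlogWitness j).im ≠ 0 := by
  by_contra h
  push Not at h
  have h0 := h 0 (by norm_num)
  have h1 := h 1 (by norm_num)
  have h2 := h 2 le_rfl
  rw [wlogWitness_zero, mul_one, phaseChar, Complex.exp_ofReal_mul_I_im, Nat.cast_zero, zero_mul,
    add_zero] at h0
  rw [wlogWitness_one, mul_one, phaseChar, Complex.exp_ofReal_mul_I_im, Nat.cast_one, one_mul] at h1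
  rw [wlogWitness_two, phaseChar, Complex.mul_im, Complex.exp_ofReal_mul_I_re,
    Complex.exp_ofReal_mul_I_im, Complex.I_re, Complex.I_im, mul_one, mul_zero, add_zero,
    Nat.cast_ofNat] at h2
  -- h0 : sin r = 0, h1 : sin (r + s) = 0, h2 : cos (r + 2 * s) = 0
  have hc1 : Real.cos (r + s) ^ 2 = 1 := by nlinarith [Real.sin_sq_add_cos_sq (r + s)]
  have hc0 : Real.cos r ^ 2 = 1 := by nlinarith [Real.sin_sq_add_cos_sq r]
  have hkey : Real.cos (r + 2 * s) = (2 * Real.cos (r + s) ^ 2 - 1) * Real.cos r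
      + 2 * Real.sin (r + s) * Real.cos (r + s) * Real.sin r := by
    have : r + 2 * s = 2 * (r + s) - r := by ring
    rw [this, Real.cos_sub, Real.cos_two_mul, Real.sin_two_mul]
  rw [h0, h1, hc1, h2] at hkey
  nlinarith

/-- The same witness phrased as the negation of the printed "without loss of generality": there is a
triple of values for which NO choice of the two phases makes all three real.
[cite: Enflo2023, v2 p.6, insert (tex L198–L204)] -/
theorem exists_not_wlog_real :
    ∃ z : ℕ → ℂ, ∀ r s : ℝ, ¬ (∀ j ≤ 2, (phaseChar r s j * z j).im = 0) := by
  refine ⟨wlogWitness, fun r s h => ?_⟩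
  obtain ⟨j, hj, hne⟩ := not_wlog_real_three r s
  exact hne (h j hj)

end PhaseWlog

end Literature.Analysis.OperatorTheory.Enflo2023

end
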